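import Mathlib
import Summits.Ventures.PercRepro2.BHKAvoid
import Summits.Ventures.PercRepro2.BHKEvents
import Summits.Ventures.PercRepro2.VdBKahn
import Summits.Ventures.PercRepro2.SideAgreement
import Summits.Ventures.PercRepro2.SideBridge
import Summits.Ventures.PercRepro2.HCovFns
import Summits.Ventures.PercRepro2.TypedSpectator

/-!
# The same-side / cross-side bound `P_Q(b ∈ C₂)·Cov_Q(1_{b∈C₁}, 1_{o∈C₁}) ≤ −Cov_Q(1_{b∈C₂}, 1_{o∈C₁})`
(blind cell PercRepro2, mine-2 g55, 2026-08-29; `conjectures/MINE-2.md` M2-118)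

With `Q = {a₁ ↮ a₂}`, `lo = {o ∈ C(a₁)}`, `lb = {b ∈ C(a₁)}`, `hb = {b ∈ C(a₂)}` and the cleared
notation `P = P(Q)`, `A = P(Q, hb)`, `B = P(Q, lb)`, `L = P(Q, lo)`, `M = P(Q, lo, lb)`,
`C = P(Q, lo, hb)`, the **one-copy inequality**

  **`same_side_le_cross`**:  `A·(M·P − B·L) ≤ P·(A·L − C·P)`

(for every weight vector), i.e. `P_Q(hb)·Cov_Q(lb, lo) ≤ −Cov_Q(hb, lo)` when `P(Q) > 0`: the
positive same-side correlation of `o` and `b` with `a₁`, weighted by the probability that `b`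
sits on `a₂`'s side, is at most the negative cross-side correlation.  Proof: BHK06 Thm 1.4 with
the AVOIDED SET `X = {a₂, b}` (`bhk_cross_cluster_avoid`, `s = a₁`): on `R = {a₁ ↮ a₂, a₁ ↮ b}`
the events `lo` (of `C(a₁)`) and `hb` (of `C(a₂)`) are negatively correlated, and `R ∩ hb = Q ∩ hb`
(`b ∈ C(a₂)` excludes `b ∈ C(a₁)` on `Q`), so `C·(P − B) ≤ (L − M)·A`; van den Berg–Kahn Thm 1.1
(`vdBK_pair`) gives `L·B ≤ M·P`; and the algebraic identity
`(P − B)·[P(AL − CP) − A(MP − BL)] = P²·[(L − M)A − C(P − B)] + AB·(MP − LB)` closes the case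
`P > B`, while `P = B` forces `A = C = 0`.  Mined from the typed row of a pendant `a₃` at `b`
(`TypedPendantA3AtB.lean`): the spectator-weighted form of this inequality and its mirror are
exactly what the sign of that row needs (`PendantA3BHCov.lean`).

Also here: **`biForm_covKer`** (the bilinear form of the two-copy covariance kernel
`1_Q(y)1_Q(w)(g(y) − g(w))(h(y) − h(w))` is `2·[P(Q)E[1_Q g h] − E[1_Q g]E[1_Q h]]`) and the signs
**`biForm_covKer_lo_sigma_nonneg`** / **`biForm_covKer_ho_sigma_nonneg`** of the two root-row
covariances `Cov_Q(1_{o∈C(a₁)}, σ_b)`, `Cov_Q(1_{o∈C(a₂)}, −σ_b)` (BHK 1.3 + 1.4, one copy).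
Own work; standard axioms.
-/

namespace Summit.Ventures.PercRepro2

namespace CovForm

namespace SideBound

/-! ## The algebraic core -/

section Algebra

variable {R : Type*} [Field R] [LinearOrder R] [IsStrictOrderedRing R]

/-- **The algebraic core**: from `C(P − B) ≤ (L − M)A` (BHK 1.4 on the avoidance `{a₂, b}`) and
`LB ≤ MP` (vdB–Kahn), with `0 ≤ C ≤ A ≤ P − B` and `0 ≤ B ≤ P`: `A(MP − BL) ≤ P(AL − CP)`. -/
lemma key_ineq {P A B L M C : R} (hA : 0 ≤ A) (hB : 0 ≤ B) (hC : 0 ≤ C) (hBP : B ≤ P)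
    (hAle : A ≤ P - B) (hCA : C ≤ A) (hstar : C * (P - B) ≤ (L - M) * A)
    (hdia : L * B ≤ M * P) :
    A * (M * P - B * L) ≤ P * (A * L - C * P) := by
  rcases (sub_nonneg.2 hBP).lt_or_eq with hpos | h0
  · have key : (P - B) * (P * (A * L - C * P) - A * (M * P - B * L)) =
        P ^ 2 * ((L - M) * A - C * (P - B)) + A * B * (M * P - L * B) := by ring
    have h1 : 0 ≤ P ^ 2 * ((L - M) * A - C * (P - B)) :=
      mul_nonneg (sq_nonneg P) (sub_nonneg.2 hstar)
    have h2 : 0 ≤ A * B * (M * P - L * B) := mul_nonneg (mul_nonneg hA hB) (sub_nonneg.2 hdia)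
    by_contra hneg
    have hlt : P * (A * L - C * P) < A * (M * P - B * L) := not_le.1 hneg
    have h3 : (P - B) * (P * (A * L - C * P) - A * (M * P - B * L)) < 0 :=
      mul_neg_of_pos_of_neg hpos (by linarith)
    linarith
  · have hA0 : A = 0 := le_antisymm (by linarith) hA
    have hC0 : C = 0 := le_antisymm (by linarith) hC
    subst hA0
    subst hC0
    simp

end Algebra

/-! ## The events -/

section Sets

variable {V : Type*} {E : Type*}

/-- `Q = {a₂ ↮ a₁}` is symmetric in the roots. -/
lemma avoidAll_singleton_comm (ends : E → Sym2 V) (a₁ a₂ : V) :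
    avoidAll ends a₁ {a₂} = avoidAll ends a₂ {a₁} := by
  ext ω
  simp only [mem_avoidAll, Finset.mem_singleton, forall_eq]
  exact ⟨fun h hc => h (conn_symm hc), fun h hc => h (conn_symm hc)⟩

/-- The avoidance `{a₁ ↮ a₂, a₁ ↮ b}` is `Q ∩ {a₁ ↮ b}`. -/
lemma avoidAll_pair_eq [DecidableEq V] (ends : E → Sym2 V) (a₁ a₂ b : V) :
    avoidAll ends a₁ {a₂, b} = avoidAll ends a₂ {a₁} ∩ (connEvent ends a₁ b)ᶜ := by
  ext ω
  simp only [mem_avoidAll, Finset.mem_insert, Finset.mem_singleton, Set.mem_inter_iff,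
    Set.mem_compl_iff, mem_connEvent, forall_eq_or_imp, forall_eq]
  exact ⟨fun h => ⟨fun hc => h.1 (conn_symm hc), h.2⟩,
    fun h => ⟨fun hc => h.1 (conn_symm hc), h.2⟩⟩

/-- On `{a₂ ↔ b}` the avoidance of `b` by `a₁` follows from `a₁ ↮ a₂`. -/
lemma hb_inter_avoid_pair [DecidableEq V] (ends : E → Sym2 V) (a₁ a₂ b : V) :
    connEvent ends a₂ b ∩ avoidAll ends a₁ {a₂, b} =
      avoidAll ends a₂ {a₁} ∩ connEvent ends a₂ b := by
  ext ω
  rw [avoidAll_pair_eq]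
  simp only [Set.mem_inter_iff, Set.mem_compl_iff, mem_connEvent, mem_avoidAll,
    Finset.mem_singleton, forall_eq]
  constructor
  · rintro ⟨hb, hq, _⟩
    exact ⟨hq, hb⟩
  · rintro ⟨hq, hb⟩
    exact ⟨hb, hq, fun hc => hq (conn_trans hb (conn_symm hc))⟩

/-- `lo ∩ hb ∩ R = Q ∩ (lo ∩ hb)`. -/
lemma lo_hb_inter_avoid_pair [DecidableEq V] (ends : E → Sym2 V) (o a₁ a₂ b : V) :
    connEvent ends a₁ o ∩ connEvent ends a₂ b ∩ avoidAll ends a₁ {a₂, b} =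
      avoidAll ends a₂ {a₁} ∩ (connEvent ends a₁ o ∩ connEvent ends a₂ b) := by
  rw [Set.inter_assoc, hb_inter_avoid_pair]
  ext ω
  simp only [Set.mem_inter_iff]
  tauto

/-- `lo ∩ R = (Q ∩ lo) ∩ lbᶜ`. -/
lemma lo_inter_avoid_pair [DecidableEq V] (ends : E → Sym2 V) (o a₁ a₂ b : V) :
    connEvent ends a₁ o ∩ avoidAll ends a₁ {a₂, b} =
      avoidAll ends a₂ {a₁} ∩ connEvent ends a₁ o ∩ (connEvent ends a₁ b)ᶜ := by
  rw [avoidAll_pair_eq]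
  ext ω
  simp only [Set.mem_inter_iff]
  tauto

/-- `Q ∩ hb ⊆ Q ∩ lbᶜ`. -/
lemma Q_inter_hb_subset (ends : E → Sym2 V) (a₁ a₂ b : V) :
    avoidAll ends a₂ {a₁} ∩ connEvent ends a₂ b ⊆
      avoidAll ends a₂ {a₁} ∩ (connEvent ends a₁ b)ᶜ := by
  rintro ω ⟨hq, hb⟩
  refine ⟨hq, fun hc => ?_⟩
  have hq' : ¬ Conn ends ω a₂ a₁ := by
    simpa [mem_avoidAll] using hq
  exact hq' (conn_trans hb (conn_symm hc))

end Sets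

/-! ## The one-copy inequalities -/

section Prob

variable {V : Type*} {E : Type*} [Fintype E] [DecidableEq E] [Fintype V] [DecidableEq V]
  {R : Type*} [Field R] [LinearOrder R] [IsStrictOrderedRing R]

/-- **BHK 1.4 with the avoided set `{a₂, b}`**, in the `Q`-vocabulary:
`P(Q, lo, hb)·(P(Q) − P(Q, lb)) ≤ (P(Q, lo) − P(Q, lo, lb))·P(Q, hb)`. -/
lemma cross_avoid_pair (p : E → R) (hp : IsProbVec p) (ends : E → Sym2 V) (o a₁ a₂ b : V) :
    prob p (avoidAll ends a₂ {a₁} ∩ (connEvent ends a₁ o ∩ connEvent ends a₂ b)) *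
        (prob p (avoidAll ends a₂ {a₁}) -
          prob p (avoidAll ends a₂ {a₁} ∩ connEvent ends a₁ b)) ≤
      (prob p (avoidAll ends a₂ {a₁} ∩ connEvent ends a₁ o) -
          prob p (avoidAll ends a₂ {a₁} ∩ (connEvent ends a₁ o ∩ connEvent ends a₁ b))) *
        prob p (avoidAll ends a₂ {a₁} ∩ connEvent ends a₂ b) := by
  have h := bhk_cross_cluster_avoid p hp ends a₁ a₂ (X := {a₂, b})
    (Finset.mem_insert_self a₂ {b}) (isUpperSet_memFam o) (isUpperSet_memFam b)
  rw [clusterInEvent_memFam, clusterInEvent_memFam, lo_hb_inter_avoid_pair, hb_inter_avoid_pair,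
    lo_inter_avoid_pair, avoidAll_pair_eq] at h
  have e1 := prob_inter_add_prob_inter_compl p (avoidAll ends a₂ {a₁}) (connEvent ends a₁ b)
  have e2 := prob_inter_add_prob_inter_compl p (avoidAll ends a₂ {a₁} ∩ connEvent ends a₁ o)
    (connEvent ends a₁ b)
  rw [Set.inter_assoc] at e2
  have e3 : prob p (avoidAll ends a₂ {a₁} ∩ (connEvent ends a₁ b)ᶜ) =
      prob p (avoidAll ends a₂ {a₁}) - prob p (avoidAll ends a₂ {a₁} ∩ connEvent ends a₁ b) := by
    linarith
  have e4 : prob p (avoidAll ends a₂ {a₁} ∩ connEvent ends a₁ o ∩ (connEvent ends a₁ b)ᶜ) =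
      prob p (avoidAll ends a₂ {a₁} ∩ connEvent ends a₁ o) -
        prob p (avoidAll ends a₂ {a₁} ∩ (connEvent ends a₁ o ∩ connEvent ends a₁ b)) := by
    linarith
  rw [e3, e4] at h
  exact h

/-- **van den Berg–Kahn Thm 1.1** in the `Q`-vocabulary: `P(Q, lo)·P(Q, lb) ≤ P(Q, lo, lb)·P(Q)`. -/
lemma same_side_vdbk (p : E → R) (hp : IsProbVec p) (ends : E → Sym2 V) (o a₁ a₂ b : V) :
    prob p (avoidAll ends a₂ {a₁} ∩ connEvent ends a₁ o) *
        prob p (avoidAll ends a₂ {a₁} ∩ connEvent ends a₁ b) ≤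
      prob p (avoidAll ends a₂ {a₁} ∩ (connEvent ends a₁ o ∩ connEvent ends a₁ b)) *
        prob p (avoidAll ends a₂ {a₁}) := by
  have h := vdBK_pair p hp ends a₁ o b a₂
  rw [SideBridge.compl_conn_eq_avoidAll,
    Set.inter_comm (connEvent ends a₁ o) (avoidAll ends a₂ {a₁}),
    Set.inter_comm (connEvent ends a₁ b) (avoidAll ends a₂ {a₁}),
    Set.inter_comm (connEvent ends a₁ o ∩ connEvent ends a₁ b) (avoidAll ends a₂ {a₁})] at h
  exact h

/-- **BHK 1.4 on the whole graph** in the `Q`-vocabulary: `P(Q, lo, hb)·P(Q) ≤ P(Q, lo)·P(Q, hb)`. -/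
lemma cross_whole (p : E → R) (hp : IsProbVec p) (ends : E → Sym2 V) (o a₁ a₂ b : V) :
    prob p (avoidAll ends a₂ {a₁} ∩ (connEvent ends a₁ o ∩ connEvent ends a₂ b)) *
        prob p (avoidAll ends a₂ {a₁}) ≤
      prob p (avoidAll ends a₂ {a₁} ∩ connEvent ends a₁ o) *
        prob p (avoidAll ends a₂ {a₁} ∩ connEvent ends a₂ b) := by
  have h := bhk_cross_cluster p hp ends a₁ a₂ (isUpperSet_memFam o) (isUpperSet_memFam b)
  rw [clusterInEvent_memFam, clusterInEvent_memFam, SideBridge.compl_conn_eq_avoidAll,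
    Set.inter_comm (connEvent ends a₁ o) (avoidAll ends a₂ {a₁}),
    Set.inter_comm (connEvent ends a₂ b) (avoidAll ends a₂ {a₁}),
    Set.inter_comm (connEvent ends a₁ o ∩ connEvent ends a₂ b) (avoidAll ends a₂ {a₁})] at h
  exact h

/-- **BHK 1.4 on the whole graph, mirror**: `P(Q, ho, lb)·P(Q) ≤ P(Q, ho)·P(Q, lb)`. -/
lemma cross_whole_mirror (p : E → R) (hp : IsProbVec p) (ends : E → Sym2 V) (o a₁ a₂ b : V) :
    prob p (avoidAll ends a₂ {a₁} ∩ (connEvent ends a₂ o ∩ connEvent ends a₁ b)) *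
        prob p (avoidAll ends a₂ {a₁}) ≤
      prob p (avoidAll ends a₂ {a₁} ∩ connEvent ends a₂ o) *
        prob p (avoidAll ends a₂ {a₁} ∩ connEvent ends a₁ b) := by
  have h := cross_whole p hp ends o a₂ a₁ b
  rwa [avoidAll_singleton_comm] at h

/-- **van den Berg–Kahn, mirror**: `P(Q, ho)·P(Q, hb) ≤ P(Q, ho, hb)·P(Q)`. -/
lemma same_side_vdbk_mirror (p : E → R) (hp : IsProbVec p) (ends : E → Sym2 V) (o a₁ a₂ b : V) :
    prob p (avoidAll ends a₂ {a₁} ∩ connEvent ends a₂ o) *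
        prob p (avoidAll ends a₂ {a₁} ∩ connEvent ends a₂ b) ≤
      prob p (avoidAll ends a₂ {a₁} ∩ (connEvent ends a₂ o ∩ connEvent ends a₂ b)) *
        prob p (avoidAll ends a₂ {a₁}) := by
  have h := same_side_vdbk p hp ends o a₂ a₁ b
  rwa [avoidAll_singleton_comm] at h

/-- **The same-side / cross-side bound** (M2-118): with `Q = {a₁ ↮ a₂}`,
`P(Q, hb)·[P(Q, lo, lb)·P(Q) − P(Q, lb)·P(Q, lo)] ≤ P(Q)·[P(Q, hb)·P(Q, lo) − P(Q, lo, hb)·P(Q)]`,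
i.e. `P_Q(b ∈ C₂)·Cov_Q(1_{b∈C₁}, 1_{o∈C₁}) ≤ −Cov_Q(1_{b∈C₂}, 1_{o∈C₁})`. -/
theorem same_side_le_cross (p : E → R) (hp : IsProbVec p) (ends : E → Sym2 V) (o a₁ a₂ b : V) :
    prob p (avoidAll ends a₂ {a₁} ∩ connEvent ends a₂ b) *
        (prob p (avoidAll ends a₂ {a₁} ∩ (connEvent ends a₁ o ∩ connEvent ends a₁ b)) *
            prob p (avoidAll ends a₂ {a₁}) -
          prob p (avoidAll ends a₂ {a₁} ∩ connEvent ends a₁ b) *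
            prob p (avoidAll ends a₂ {a₁} ∩ connEvent ends a₁ o)) ≤
      prob p (avoidAll ends a₂ {a₁}) *
        (prob p (avoidAll ends a₂ {a₁} ∩ connEvent ends a₂ b) *
            prob p (avoidAll ends a₂ {a₁} ∩ connEvent ends a₁ o) -
          prob p (avoidAll ends a₂ {a₁} ∩ (connEvent ends a₁ o ∩ connEvent ends a₂ b)) *
            prob p (avoidAll ends a₂ {a₁})) := by
  have hstar := cross_avoid_pair p hp ends o a₁ a₂ b
  have hdia := same_side_vdbk p hp ends o a₁ a₂ b
  have hA := prob_nonneg hp (avoidAll ends a₂ {a₁} ∩ connEvent ends a₂ b)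
  have hB := prob_nonneg hp (avoidAll ends a₂ {a₁} ∩ connEvent ends a₁ b)
  have hC := prob_nonneg hp
    (avoidAll ends a₂ {a₁} ∩ (connEvent ends a₁ o ∩ connEvent ends a₂ b))
  have hBP := prob_inter_le_left hp (avoidAll ends a₂ {a₁}) (connEvent ends a₁ b)
  have hCA := prob_mono hp (show avoidAll ends a₂ {a₁} ∩ (connEvent ends a₁ o ∩ connEvent ends a₂ b) ⊆
    avoidAll ends a₂ {a₁} ∩ connEvent ends a₂ b from
    Set.inter_subset_inter (subset_refl _) Set.inter_subset_right)
  have hAle' := prob_mono hp (Q_inter_hb_subset ends a₁ a₂ b)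
  have e1 := prob_inter_add_prob_inter_compl p (avoidAll ends a₂ {a₁}) (connEvent ends a₁ b)
  have hAle : prob p (avoidAll ends a₂ {a₁} ∩ connEvent ends a₂ b) ≤
      prob p (avoidAll ends a₂ {a₁}) - prob p (avoidAll ends a₂ {a₁} ∩ connEvent ends a₁ b) := by
    linarith
  exact key_ineq hA hB hC hBP hAle hCA hstar (by linarith [hdia])

/-- **The mirror bound** (`a₁ ↔ a₂`): `P(Q, lb)·[P(Q, ho, hb)·P(Q) − P(Q, hb)·P(Q, ho)] ≤
P(Q)·[P(Q, lb)·P(Q, ho) − P(Q, ho, lb)·P(Q)]`. -/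
theorem same_side_le_cross_mirror (p : E → R) (hp : IsProbVec p) (ends : E → Sym2 V)
    (o a₁ a₂ b : V) :
    prob p (avoidAll ends a₂ {a₁} ∩ connEvent ends a₁ b) *
        (prob p (avoidAll ends a₂ {a₁} ∩ (connEvent ends a₂ o ∩ connEvent ends a₂ b)) *
            prob p (avoidAll ends a₂ {a₁}) -
          prob p (avoidAll ends a₂ {a₁} ∩ connEvent ends a₂ b) *
            prob p (avoidAll ends a₂ {a₁} ∩ connEvent ends a₂ o)) ≤
      prob p (avoidAll ends a₂ {a₁}) *
        (prob p (avoidAll ends a₂ {a₁} ∩ connEvent ends a₁ b) *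
            prob p (avoidAll ends a₂ {a₁} ∩ connEvent ends a₂ o) -
          prob p (avoidAll ends a₂ {a₁} ∩ (connEvent ends a₂ o ∩ connEvent ends a₁ b)) *
            prob p (avoidAll ends a₂ {a₁})) := by
  have h := same_side_le_cross p hp ends o a₂ a₁ b
  rwa [avoidAll_singleton_comm] at h

end Prob

/-! ## The bilinear form of the covariance kernel -/

section BiForm

variable {V : Type*} {E : Type*} [Fintype E] [DecidableEq E] {R : Type*} [Field R]

/-- **The bilinear form of the covariance kernel** `1_Q(y)1_Q(w)(g(y) − g(w))(h(y) − h(w))` is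
`2·[E[1_Q]·E[1_Q g h] − E[1_Q g]·E[1_Q h]]`. -/
lemma biForm_covKer (p : E → R) (ends : E → Sym2 V) (a₁ a₂ : V) (g h : Config E → R) :
    biForm p p (TypedA3.covKer ends a₁ a₂ g h) =
      2 * (expect p (iQ ends a₁ a₂) * expect p (fun ω => iQ ends a₁ a₂ ω * (g ω * h ω)) -
        expect p (fun ω => iQ ends a₁ a₂ ω * g ω) * expect p (fun ω => iQ ends a₁ a₂ ω * h ω)) := by
  unfold biForm expect TypedA3.covKer
  rw [Finset.sum_mul_sum, Finset.sum_mul_sum]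
  rw [show (∑ x : Config E, ∑ y : Config E, weight p x * weight p y *
      (iQ ends a₁ a₂ x * iQ ends a₁ a₂ y * ((g x - g y) * (h x - h y)))) =
      (∑ x : Config E, ∑ y : Config E,
        (weight p x * iQ ends a₁ a₂ x) * (weight p y * (iQ ends a₁ a₂ y * (g y * h y)))) -
      (∑ x : Config E, ∑ y : Config E,
        (weight p x * (iQ ends a₁ a₂ x * g x)) * (weight p y * (iQ ends a₁ a₂ y * h y))) -
      (∑ x : Config E, ∑ y : Config E,
        (weight p y * (iQ ends a₁ a₂ y * g y)) * (weight p x * (iQ ends a₁ a₂ x * h x))) +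
      (∑ x : Config E, ∑ y : Config E,
        (weight p y * iQ ends a₁ a₂ y) * (weight p x * (iQ ends a₁ a₂ x * (g x * h x)))) from by
    simp only [← Finset.sum_add_distrib, ← Finset.sum_sub_distrib]
    exact Finset.sum_congr rfl fun x _ => Finset.sum_congr rfl fun y _ => by ring]
  rw [Finset.sum_comm (f := fun x y =>
      (weight p y * (iQ ends a₁ a₂ y * g y)) * (weight p x * (iQ ends a₁ a₂ x * h x))),
    Finset.sum_comm (f := fun x y =>
      (weight p y * iQ ends a₁ a₂ y) * (weight p x * (iQ ends a₁ a₂ x * (g x * h x))))]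
  ring

/-- `E[−f] = −E[f]`. -/
lemma expect_neg' (p : E → R) (f : Config E → R) :
    expect p (fun ω => -(f ω)) = -expect p f := by
  simp [expect, Finset.sum_neg_distrib]

/-- `E[1_Q · 1_{o∈C₁} · σ_b] = P(Q, lo, lb) − P(Q, lo, hb)`. -/
lemma expect_iQ_iL_sigma (p : E → R) (ends : E → Sym2 V) (o a₁ a₂ b : V) :
    expect p (fun ω => iQ ends a₁ a₂ ω * (iL ends a₁ o ω * sigma ends a₁ a₂ b ω)) =
      prob p (avoidAll ends a₂ {a₁} ∩ (connEvent ends a₁ o ∩ connEvent ends a₁ b)) -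
        prob p (avoidAll ends a₂ {a₁} ∩ (connEvent ends a₁ o ∩ connEvent ends a₂ b)) := by
  rw [← expect_ind3, ← expect_ind3, ← expect_sub]
  congr 1
  funext ω
  simp only [Pi.sub_apply, iQ, iL, iH, sigma]
  ring

/-- `E[1_Q · 1_{o∈C₂} · σ_b] = P(Q, ho, lb) − P(Q, ho, hb)`. -/
lemma expect_iQ_iH_sigma (p : E → R) (ends : E → Sym2 V) (o a₁ a₂ b : V) :
    expect p (fun ω => iQ ends a₁ a₂ ω * (iH ends a₂ o ω * sigma ends a₁ a₂ b ω)) =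
      prob p (avoidAll ends a₂ {a₁} ∩ (connEvent ends a₂ o ∩ connEvent ends a₁ b)) -
        prob p (avoidAll ends a₂ {a₁} ∩ (connEvent ends a₂ o ∩ connEvent ends a₂ b)) := by
  rw [← expect_ind3, ← expect_ind3, ← expect_sub]
  congr 1
  funext ω
  simp only [Pi.sub_apply, iQ, iL, iH, sigma]
  ring

/-- `E[1_Q · σ_b] = P(Q, lb) − P(Q, hb)`. -/
lemma expect_iQ_sigma (p : E → R) (ends : E → Sym2 V) (a₁ a₂ b : V) :
    expect p (fun ω => iQ ends a₁ a₂ ω * sigma ends a₁ a₂ b ω) =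
      prob p (avoidAll ends a₂ {a₁} ∩ connEvent ends a₁ b) -
        prob p (avoidAll ends a₂ {a₁} ∩ connEvent ends a₂ b) := by
  rw [← expect_ind2, ← expect_ind2, ← expect_sub]
  congr 1
  funext ω
  simp only [Pi.sub_apply, iQ, iL, iH, sigma]
  ring

/-- `E[1_Q · 1_{v∈C₁}] = P(Q, v ∈ C₁)`. -/
lemma expect_iQ_iL (p : E → R) (ends : E → Sym2 V) (a₁ a₂ v : V) :
    expect p (fun ω => iQ ends a₁ a₂ ω * iL ends a₁ v ω) =
      prob p (avoidAll ends a₂ {a₁} ∩ connEvent ends a₁ v) := by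
  rw [← expect_ind2]
  rfl

/-- `E[1_Q · 1_{v∈C₂}] = P(Q, v ∈ C₂)`. -/
lemma expect_iQ_iH (p : E → R) (ends : E → Sym2 V) (a₁ a₂ v : V) :
    expect p (fun ω => iQ ends a₁ a₂ ω * iH ends a₂ v ω) =
      prob p (avoidAll ends a₂ {a₁} ∩ connEvent ends a₂ v) := by
  rw [← expect_ind2]
  rfl

end BiForm

section Signs

variable {V : Type*} {E : Type*} [Fintype E] [DecidableEq E] [Fintype V] [DecidableEq V]
  {R : Type*} [Field R] [LinearOrder R] [IsStrictOrderedRing R]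

/-- **The root-row covariance at `a₂` is nonnegative** (BHK 1.3 + 1.4, one copy):
`B(Cov(1_{o∈C₁}, σ_b)) = 2·[(P(Q)P(Q,lo,lb) − P(Q,lo)P(Q,lb)) + (P(Q,lo)P(Q,hb) − P(Q)P(Q,lo,hb))] ≥ 0`. -/
theorem biForm_covKer_lo_sigma_nonneg (p : E → R) (hp : IsProbVec p) (ends : E → Sym2 V)
    (o a₁ a₂ b : V) :
    0 ≤ biForm p p (TypedA3.covKer ends a₁ a₂ (iL ends a₁ o) (sigma ends a₁ a₂ b)) := by
  rw [biForm_covKer, expect_iQ_iL_sigma, expect_iQ_iL, expect_iQ_sigma, expect_f1]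
  have h1 := same_side_vdbk p hp ends o a₁ a₂ b
  have h2 := cross_whole p hp ends o a₁ a₂ b
  nlinarith [h1, h2]

/-- **The root-row covariance at `a₁` is nonnegative** (the mirror, with `σ` read from `a₂`):
`B(Cov(1_{o∈C₂}, −σ_b)) ≥ 0`. -/
theorem biForm_covKer_ho_sigma_nonneg (p : E → R) (hp : IsProbVec p) (ends : E → Sym2 V)
    (o a₁ a₂ b : V) :
    0 ≤ biForm p p (TypedA3.covKer ends a₁ a₂ (iH ends a₂ o) (sigma ends a₂ a₁ b)) := by
  have e : (fun ω : Config E => (iQ ends a₁ a₂ ω : R) * (iH ends a₂ o ω * sigma ends a₂ a₁ b ω)) =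
      fun ω : Config E => -((iQ ends a₁ a₂ ω : R) * (iH ends a₂ o ω * sigma ends a₁ a₂ b ω)) := by
    funext ω
    simp only [sigma, iL, iH]
    ring
  have e' : (fun ω : Config E => (iQ ends a₁ a₂ ω : R) * sigma ends a₂ a₁ b ω) =
      fun ω : Config E => -((iQ ends a₁ a₂ ω : R) * sigma ends a₁ a₂ b ω) := by
    funext ω
    simp only [sigma, iL, iH]
    ring
  rw [biForm_covKer, e, e', expect_neg', expect_neg', expect_iQ_iH_sigma, expect_iQ_iH,
    expect_iQ_sigma, expect_f1]
  have h1 := same_side_vdbk_mirror p hp ends o a₁ a₂ b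
  have h2 := cross_whole_mirror p hp ends o a₁ a₂ b
  nlinarith [h1, h2]

end Signs

end SideBound

end CovForm

end Summit.Ventures.PercRepro2
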